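import Summits.QuantumFields.YangMills.Theorems.F4SubCurvatureDoorFibreDichotomyHarmonicMomentODE
import Mathlib
import HarnessLib

/-!
# LINE g21-B «fibre dichotomy» (⟨stmt-QuantumFields-23125⟩) — B4 helper: the radial equation of the harmonic moments of a
# Helmholtz solution that is `C²` OFF THE ORIGIN only; mean zero of harmonics on `S³`

Helper toward the registered stub B4 `stub_singleShellDichotomy` (stub plan `Lines/fibre_dichotomy_stubplans.md`, step H3 in the form
consumed by the assembly, and the mean-zero input of step H7).  The patched kernel `Kp` of the landed rung R-B4e `MirrorPatching` is
`C²` on `ℝ⁴ ∖ 0` only and solves `Σᵢ ∂ᵢ² Kp = s · Kp` there; this file transfers the globally-`C²` statement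
`…FibreDichotomyHarmonicMomentODE.harmonicMoment_ode` to that setting by a smooth radial cut-off (`Real.smoothTransition`) equal to `1`
outside the ball of radius `ε` and to `0` near the origin, for every `ε > 0`:

* `laplacian_eq_sum_iteratedFDeriv_single` — the rung's Laplacian `Σᵢ D²f(x)(eᵢ,eᵢ)` is Mathlib's `Δ f x`;
* `radialODE_of_helmholtz_offOrigin` — for `u` with `ContDiffAt ℝ 2 u x` and `Δ u x = s u x` at every `x ≠ 0` and a harmonic
  homogeneous `Y` of degree `L`, the moments `g(r) = ∫ Y(α) u(rα) dσ`, `dg = ∫ Y Du(rα)α`, `ddg = ∫ Y D²u(rα)(α,α)` satisfy, for every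
  `r > 0`, `dg = g'`, `ddg = dg'` and `ddg + (3/r) dg − (L(L+2)/r² + s) g = 0` — the hypotheses of the rung R-B4a `RadialODEDichotomy`;
* `sphere_integral_harmonic_eq_zero` — `∫_{S³} Y dσ = 0` for harmonic homogeneous `Y` of degree `L ≥ 1` (the same equation for `u ≡ 1`,
  `s = 0`, read at `r = 1`).

Mathlib + tree only; no `sorry`; no new definitions.  HONEST LABEL: analysis helper for a registered stub of an OPEN line; B4, B5, S1, S2,
⟨23125⟩, ⟨23035⟩, R2d and the Yang–Mills mass gap remain OPEN; no summit is proved by a line.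
-/

noncomputable section

open MeasureTheory MeasureTheory.Measure Set Function Filter Topology Metric Module InnerProductSpace
open scoped RealInnerProductSpace ContDiff Laplacian BigOperators

namespace Summit.QuantumFields.YangMills.Theorems.F4SubCurvatureDoorHarmonicMomentODE

open Literature.Analysis.Calculus.MvPoly (toFun lap contDiff_toFun)
open Summit.QuantumFields.YangMills.Theorems.F4SubCurvatureDoorLaplaceFourierRegistered (E4)

/-! ## The two Laplacians agree -/

/-- The Laplacian written as `Σᵢ D²f(x)(eᵢ, eᵢ)` over the coordinate frame of `ℝ⁴` (the form used by the rung `MirrorPatching`) is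
Mathlib's `Δ f x`. -/
theorem laplacian_eq_sum_iteratedFDeriv_single (f : E4 → ℝ) (x : E4) :
    (Δ f) x = ∑ i : Fin 4, iteratedFDeriv ℝ 2 f x (fun _ => EuclideanSpace.single i (1 : ℝ)) := by
  rw [laplacian_eq_iteratedFDeriv_orthonormalBasis f (EuclideanSpace.basisFun (Fin 4) ℝ)]
  refine Finset.sum_congr rfl fun i _ => ?_
  congr 1
  funext j
  fin_cases j <;> simp [EuclideanSpace.basisFun_apply]

/-! ## A smooth radial cut-off -/

/-- The cut-off profile `ψ_ε(t) = smoothTransition (2t/ε − 1)`: smooth, `= 0` for `t ≤ ε/2`, `= 1` for `t ≥ ε`. -/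
theorem cutoff_props {ε : ℝ} (hε : 0 < ε) :
    ContDiff ℝ ∞ (fun t : ℝ => Real.smoothTransition (2 * t / ε - 1)) ∧
      (∀ t, t ≤ ε / 2 → Real.smoothTransition (2 * t / ε - 1) = 0) ∧
      (∀ t, ε ≤ t → Real.smoothTransition (2 * t / ε - 1) = 1) := by
  refine ⟨Real.smoothTransition.contDiff.comp (by fun_prop), fun t ht => ?_, fun t ht => ?_⟩
  · refine Real.smoothTransition.zero_of_nonpos ?_
    have : 2 * t / ε ≤ 1 := by rw [div_le_one hε]; linarith
    linarith
  · refine Real.smoothTransition.one_of_one_le ?_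
    have : 2 ≤ 2 * t / ε := by rw [le_div_iff₀ hε]; linarith
    linarith

/-- **The cut-off kernel.**  For `u` that is `C²` off the origin and `ε > 0`, `v(x) = ψ_ε(‖x‖) u(x)` is `C²` on all of `ℝ⁴` and agrees
with `u` near every point of `{‖x‖ > ε}`. -/
theorem cutoff_kernel {u : E4 → ℝ} (hu : ∀ x : E4, x ≠ 0 → ContDiffAt ℝ 2 u x) {ε : ℝ} (hε : 0 < ε) :
    ContDiff ℝ 2 (fun x : E4 => Real.smoothTransition (2 * ‖x‖ / ε - 1) * u x) ∧
      ∀ x : E4, ε < ‖x‖ → (fun y : E4 => Real.smoothTransition (2 * ‖y‖ / ε - 1) * u y) =ᶠ[𝓝 x] u := by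
  obtain ⟨hψ, hψ0, hψ1⟩ := cutoff_props hε
  refine ⟨contDiff_iff_contDiffAt.2 fun x => ?_, fun x hx => ?_⟩
  · by_cases hx : ‖x‖ < ε / 2
    · -- near `x` the function vanishes identically
      have hev : (fun y : E4 => Real.smoothTransition (2 * ‖y‖ / ε - 1) * u y) =ᶠ[𝓝 x] fun _ => 0 := by
        filter_upwards [(isOpen_lt continuous_norm continuous_const).mem_nhds hx] with y hy
        rw [hψ0 ‖y‖ (le_of_lt hy), zero_mul]
      exact (contDiffAt_const (c := (0 : ℝ))).congr_of_eventuallyEq hev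
    · have hx0 : x ≠ 0 := by
        intro h
        rw [h, norm_zero] at hx
        exact hx (by positivity)
      have h1 : ContDiffAt ℝ 2 (fun y : E4 => Real.smoothTransition (2 * ‖y‖ / ε - 1)) x :=
        (contDiff_infty.1 hψ 2).contDiffAt.comp x (contDiffAt_norm ℝ hx0)
      exact h1.mul (hu x hx0)
  · filter_upwards [(isOpen_lt continuous_const continuous_norm).mem_nhds hx] with y hy
    rw [hψ1 ‖y‖ (le_of_lt hy), one_mul]

/-! ## The radial equation for kernels that are `C²` off the origin -/

/-- **The radial equation of the harmonic moments of a Helmholtz solution off the origin.**  Let `u : ℝ⁴ → ℝ` be `C²` at every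
`x ≠ 0` with `Δ u x = s · u x` there, `Y` a harmonic homogeneous polynomial of degree `L`, and for `r > 0` let
`g(r) = ∫ Y(α) u(rα) dσ`, `dg(r) = ∫ Y(α) Du(rα) α dσ`, `ddg(r) = ∫ Y(α) D²u(rα)(α, α) dσ` (`σ = volume.toSphere` on `S³`).  Then for every
`r > 0`: `g' = dg`, `dg' = ddg`, and `ddg + (3/r) dg − (L(L+2)/r² + s) g = 0` — the hypotheses of R-B4a `RadialODEDichotomy`. -/
theorem radialODE_of_helmholtz_offOrigin {u : E4 → ℝ} (hu : ∀ x : E4, x ≠ 0 → ContDiffAt ℝ 2 u x) {s : ℝ}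
    (hpde : ∀ x : E4, x ≠ 0 → (Δ u) x = s * u x)
    {P : MvPolynomial (Fin 4) ℝ} {L : ℕ} (hP : P.IsHomogeneous L) (hharm : lap P = 0) {g dg ddg : ℝ → ℝ}
    (hg : ∀ r, 0 < r → g r = ∫ α, toFun P (α : E4) * u (r • (α : E4)) ∂(volume : Measure E4).toSphere)
    (hdg : ∀ r, 0 < r → dg r = ∫ α, toFun P (α : E4) * fderiv ℝ u (r • (α : E4)) (α : E4) ∂(volume : Measure E4).toSphere)
    (hddg : ∀ r, 0 < r → ddg r = ∫ α, toFun P (α : E4) * fderiv ℝ (fderiv ℝ u) (r • (α : E4)) (α : E4) (α : E4)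
      ∂(volume : Measure E4).toSphere) :
    ∀ r, 0 < r → (HasDerivAt g (dg r) r ∧ HasDerivAt dg (ddg r) r) ∧
      ddg r + 3 / r * dg r - (((L : ℝ) * ((L : ℝ) + 2)) / r ^ 2 + s) * g r = 0 := by
  intro r hr
  -- cut off at `ε = r/2`
  set ε : ℝ := r / 2 with hε_def
  have hε : 0 < ε := by positivity
  have hεr : ε < r := by rw [hε_def]; linarith
  set v : E4 → ℝ := fun x => Real.smoothTransition (2 * ‖x‖ / ε - 1) * u x with hv_def
  obtain ⟨hv, hvu⟩ := cutoff_kernel hu hε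
  -- `v` and `u`, with their first two derivatives, agree on `{‖x‖ > ε}`
  have hvu0 : ∀ x : E4, ε < ‖x‖ → v x = u x := fun x hx => (hvu x hx).eq_of_nhds
  have hvu1 : ∀ x : E4, ε < ‖x‖ → fderiv ℝ v x = fderiv ℝ u x := fun x hx => (hvu x hx).fderiv_eq
  have hvu2 : ∀ x : E4, ε < ‖x‖ → fderiv ℝ (fderiv ℝ v) x = fderiv ℝ (fderiv ℝ u) x := fun x hx =>
    (hvu x hx).fderiv.fderiv_eq
  -- Helmholtz for `v` on `{‖x‖ > ε}`
  have hpde_v : ∀ x : E4, ‖x‖ ∈ Ioi ε → (Δ v) x = s * v x := by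
    intro x hx
    have hx' : ε < ‖x‖ := hx
    have hx0 : x ≠ 0 := by
      intro h
      rw [h, norm_zero] at hx'
      exact lt_irrefl _ (hε.trans hx')
    rw [(laplacian_congr_nhds (hvu x hx')).eq_of_nhds, hpde x hx0, hvu0 x hx']
  -- the moments of `v`
  set Gv : ℝ → ℝ := fun ρ => ∫ α, toFun P (α : E4) * v (ρ • (α : E4)) ∂(volume : Measure E4).toSphere with hGv
  set Gv' : ℝ → ℝ := fun ρ => ∫ α, toFun P (α : E4) * fderiv ℝ v (ρ • (α : E4)) (α : E4) ∂(volume : Measure E4).toSphere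
    with hGv'
  set Gv'' : ℝ → ℝ := fun ρ => ∫ α, toFun P (α : E4) * fderiv ℝ (fderiv ℝ v) (ρ • (α : E4)) (α : E4) (α : E4)
    ∂(volume : Measure E4).toSphere with hGv''
  obtain ⟨hGvd, hGv'd, -⟩ := harmonicMoment_hasDerivAt hv P (G := Gv) (G' := Gv') (G'' := Gv'') (fun _ => rfl) (fun _ => rfl)
    (fun _ => rfl)
  have hode := harmonicMoment_ode hv isOpen_Ioi (Ioi_subset_Ioi hε.le) hpde_v hP hharm (G := Gv) (G' := Gv') (G'' := Gv'')
    (fun _ => rfl) (fun _ => rfl) (fun _ => rfl) r hεr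
  -- on `(ε, ∞)` the moments of `v` are those of `u`
  have hnorm : ∀ {ρ : ℝ}, ε < ρ → ∀ α : sphere (0 : E4) 1, ε < ‖ρ • (α : E4)‖ := fun {ρ} hρ α => by
    rwa [Literature.Analysis.FluidPDE.norm_smul_sphere (hε.le.trans hρ.le) α]
  have e0 : ∀ ρ, ε < ρ → Gv ρ = g ρ := fun ρ hρ => by
    rw [hg ρ (hε.trans hρ)]
    exact integral_congr_ae (ae_of_all _ fun α => by simp only [hvu0 _ (hnorm hρ α)])
  have e1 : ∀ ρ, ε < ρ → Gv' ρ = dg ρ := fun ρ hρ => by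
    rw [hdg ρ (hε.trans hρ)]
    exact integral_congr_ae (ae_of_all _ fun α => by simp only [hvu1 _ (hnorm hρ α)])
  have e2 : ∀ ρ, ε < ρ → Gv'' ρ = ddg ρ := fun ρ hρ => by
    rw [hddg ρ (hε.trans hρ)]
    exact integral_congr_ae (ae_of_all _ fun α => by simp only [hvu2 _ (hnorm hρ α)])
  have hnhds : Ioi ε ∈ 𝓝 r := isOpen_Ioi.mem_nhds hεr
  have ev0 : g =ᶠ[𝓝 r] Gv := by
    filter_upwards [hnhds] with ρ hρ
    exact (e0 ρ hρ).symm
  have ev1 : dg =ᶠ[𝓝 r] Gv' := by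
    filter_upwards [hnhds] with ρ hρ
    exact (e1 ρ hρ).symm
  refine ⟨⟨?_, ?_⟩, ?_⟩
  · have h := (hGvd r).congr_of_eventuallyEq ev0
    rwa [e1 r hεr] at h
  · have h := (hGv'd r).congr_of_eventuallyEq ev1
    rwa [e2 r hεr] at h
  · rw [← e0 r hεr, ← e1 r hεr, ← e2 r hεr]
    exact hode

/-! ## Mean zero of harmonics of positive degree on `S³` -/

/-- **Harmonic homogeneous polynomials of degree `L ≥ 1` have mean zero on the unit sphere `S³`** (`σ = volume.toSphere`): the
constant moment `m = ∫ Y dσ` of `u ≡ 1` (`Δ 1 = 0 = 0 · 1`) solves `−(L(L+2)/r²) m = 0`. -/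
theorem sphere_integral_harmonic_eq_zero {P : MvPolynomial (Fin 4) ℝ} {L : ℕ} (hL : 1 ≤ L) (hP : P.IsHomogeneous L)
    (hharm : lap P = 0) :
    ∫ α, toFun P (α : E4) ∂(volume : Measure E4).toSphere = 0 := by
  set m : ℝ := ∫ α, toFun P (α : E4) ∂(volume : Measure E4).toSphere with hm
  have hv : ContDiff ℝ 2 (fun _ : E4 => (1 : ℝ)) := contDiff_const
  have hΔ : ∀ x : E4, ‖x‖ ∈ Ioi (0 : ℝ) → (Δ fun _ : E4 => (1 : ℝ)) x = 0 * (fun _ : E4 => (1 : ℝ)) x := by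
    intro x _
    rw [laplacian_eq_sum_iteratedFDeriv_single, zero_mul]
    refine Finset.sum_eq_zero fun i _ => ?_
    rw [iteratedFDeriv_succ_const]
    rfl
  have hf1 : fderiv ℝ (fun _ : E4 => (1 : ℝ)) = 0 := by
    funext x
    exact fderiv_const_apply 1
  have hode := harmonicMoment_ode hv isOpen_Ioi Subset.rfl hΔ hP hharm (G := fun _ => m) (G' := fun _ => 0) (G'' := fun _ => 0)
    (fun ρ => by simp [hm]) (fun ρ => by simp [hf1]) (fun ρ => by simp) 1 (mem_Ioi.2 one_pos)
  have hL' : (0 : ℝ) < (L : ℝ) * ((L : ℝ) + 2) := by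
    have : (1 : ℝ) ≤ L := by exact_mod_cast hL
    positivity
  have : (L : ℝ) * ((L : ℝ) + 2) * m = 0 := by
    have h := hode
    simp only [one_pow, div_one, mul_zero, add_zero, zero_sub] at h
    linarith
  exact (mul_eq_zero.1 this).resolve_left hL'.ne'

end Summit.QuantumFields.YangMills.Theorems.F4SubCurvatureDoorHarmonicMomentODE

end
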